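import Summits.CriticalPhenomena.SAWScalingLimit.Theses.SAWDevelopingMap
import Summits.CriticalPhenomena.SAWScalingLimit.Theses.SAWPhaseRetrieval
import Summits.CriticalPhenomena.SAWScalingLimit.Theses.SAWCompassLattice
import Summits.CriticalPhenomena.SAWScalingLimit.Theorems.SAWDevelopingMapHexTransferCompassRealisation
import Summits.CriticalPhenomena.SAWScalingLimit.Theorems.SAWDevelopingMapHexTransferCompassEndpoints
import Summits.CriticalPhenomena.SAWScalingLimit.Theorems.SAWDevelopingMapHexTransferPortDictionary
import Summits.CriticalPhenomena.SAWScalingLimit.Theorems.SAWDevelopingMapHexTransferPortTransfer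
import Summits.CriticalPhenomena.SAWScalingLimit.Theorems.SAWDevelopingMapHexTransferLineReduction

/-!
# Line `Sketch` (quarter-turn pinning) for the crux `HexTransfer` (stmt-CriticalPhenomena-14221)

Skeleton owned by the line lead (prover-line-stmt-CriticalPhenomena-14221-0), reconstructed from the
ideator's `Sketch.lean` as quoted in `Cruxes/HexTransfer/Ideas/quarter-turn-pinning.md`
(`hexTransfer_of_quarterTurn : ThetaTransport → PortCoupling → CompassRealisation → CompassEndpoints →
SurfaceUniversality → HexTransfer := fun hΘ hP hR hE hU hHex => SAWCompassLattice.closes hR hE (hP (hΘ hHex)) hU`),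
with `PortCoupling` reshaped into the existing item `PortDictionary` (stmt-6966) and the analytic transfer
`PortDictionary → YBSquareSLE → CompassSLE`.

The crux: `HexTransfer := (DCS 2012 Conjecture 1, = the text of HexConjecture) → SAWScalingLimit`.

Composition (`HexTransfer_of`): the hexagonal hypothesis is consumed ONCE, by `stub_thetaTransport`
(Θ-transport of the chordal SLE(8/3) convergence inside the Glazman–Manolescu Yang–Baxter family, Θ ≡ π/3 ↦ π/2,
to GM's critical walk on the square tiling = `SAWCompassLattice.YBSquareSLE`); `stub_portDictionary` +
`stub_portTransfer` move it to the honest compass SAW (`CompassSLE`); `stub_compassRealisation`,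
`stub_compassEndpoints` make the compass route's `closes` applicable; `stub_surfaceUniversality` is the
D4-internal universality step compass ↔ uniform ℤ² (`SurfaceUniversality`); `SAWCompassLattice.closes` ends.

Stubs:
* `stub_thetaTransport`      : HexConjecture → YBSquareSLE            (lead; open-problem sized)   OPEN (sorry here)
* `stub_portDictionary`      : PortDictionary                          LANDED p93523 (Theorems/SAWDevelopingMapHexTransferPortDictionary.lean + 5 parts)
* `stub_portTransfer`        : PortDictionary → YBSquareSLE → CompassSLE LANDED p91040 (…PortTransfer.lean + 3 parts)
* `stub_compassRealisation`  : CompassRealisation                      LANDED p89754 (…CompassRealisation.lean)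
* `stub_compassEndpoints`    : CompassEndpoints                        LANDED p90649 (…CompassEndpoints.lean + FaceChains p89673)
* `stub_surfaceUniversality` : SurfaceUniversality                     (= stmt-6964, open-problem sized)   OPEN (sorry here)
* `stub_lineReduction`       : (HexConjecture → YBSquareSLE) → SurfaceUniversality → HexTransfer   LANDED p93700 (…LineReduction.lean: the composition)
The five landed theorems are imported (same namespace, same names); `HexTransfer_of` is `stub_lineReduction` applied to the two open stubs.
-/

namespace Summit.CriticalPhenomena.SAWScalingLimit.Cruxes.HexTransfer.Sketch

open Summit.CriticalPhenomena.SAWScalingLimit.Theses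

/-- Stub (lead). **Θ-transport**: Duminil-Copin–Smirnov Conjecture 1 on the hexagonal lattice
(`HexConjecture`, ≡ `Literature…SAW.HexSAWScalingLimit`) implies chordal SLE(8/3) convergence of
Glazman–Manolescu's critical Yang–Baxter walk on the square tiling Θ ≡ π/2 (`YBSquareSLE`, stmt-6967).
Open-problem sized: GM Thms 1–3 transport partition functions, not curve laws. -/
theorem stub_thetaTransport :
    SAWDevelopingMap.HexConjecture → SAWCompassLattice.YBSquareSLE := by
  sorry

/-- Stub. **Surface universality** (item stmt-CriticalPhenomena-6964 verbatim): the compass chordal law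
and the critical uniform ℤ² SAW law are asymptotically equal on bounded continuous test functions.
Open-problem sized (2D SAW universality in its D4-internal instance). -/
theorem stub_surfaceUniversality : SAWCompassLattice.SurfaceUniversality := by
  sorry

/-- **The line closes the crux modulo its stubs**: `HexTransfer` (stmt-CriticalPhenomena-14221, body of
route SAWDevelopingMap) from `stub_lineReduction` and the two open stubs. -/
theorem HexTransfer_of : SAWDevelopingMap.HexTransfer :=
  stub_lineReduction stub_thetaTransport stub_surfaceUniversality

/-- The same closing term against the crux item's registered declaration (shared item
stmt-CriticalPhenomena-14221 is filed under route SAWPhaseRetrieval; the four routes' `HexTransfer`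
bodies are syntactically identical, so this is `HexTransfer_of` by `Iff.rfl`/defeq). -/
theorem HexTransfer_proof : SAWPhaseRetrieval.HexTransfer :=
  HexTransfer_of

end Summit.CriticalPhenomena.SAWScalingLimit.Cruxes.HexTransfer.Sketch
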